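import Mathlib
import Summits.NavierStokesRegularity.NavierStokesRegularity.Theorems.EulerZoomLiouvillePowerGaugeEulerLiouvilleHoopNetPressureDrop
import Summits.NavierStokesRegularity.NavierStokesRegularity.Theorems.EulerZoomLiouvillePowerGaugeEulerLiouvilleHoopLateral
import Summits.NavierStokesRegularity.NavierStokesRegularity.Theorems.EulerZoomLiouvillePowerGaugeEulerLiouvilleHoopRunFreeDefs
import HarnessLib

/-!
# Hoop core — t53-NET by name: the NET AXIS PRESSURE-DROP LAW (`NsregP2.R50.AxisPressureDropLaw γ`)

Sub-problem `NavierStokesRegularity`, crux `PowerGaugeEulerLiouville` (a crux CLASS of self-similar Euler/NS strata on the MODEL lattice —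
not NS regularity, not E).  Seat ns-ezl-w3 g7, tag t53-NET (nsreg-p2 g40 ROUND-50 «THE WALL COMES FOR FREE» §1, `r50/Sketch50.lean`
6c31f8f6e879902e, text of `NsregP2.R50.AxisPressureDropLaw γ` VERBATIM over the tree's `HoopCore.discMass` (`…HoopRunFreeDefs`, LEAD g15)).

`axisPressureDropLaw γ` — for a `γ`-profile pair `(V, P)` with ANY similarity centre `c` (any straight axis), every `s₁ < s₂`, `T₀ > 0`:
`2π∫_{s₁}^{s₂}(P(σe_z) − ⟨P⟩_θ(σ,T₀))dσ ≤ 2∫_Z|DV|_F² + endFlux(s₁) + endFlux(s₂) + 2πγ[discMass(s₁,T₀) − discMass(s₂,T₀)]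
 + 2π(1−3γ)∫₀^{T₀}(discMass(s₁,t) − discMass(s₂,t))dt/t + 2π([E_c] − [F_c])` — EVERY term on the right except `2∫_Z|DV|_F²` lives on the two
END DISCS: no wall-velocity clause, no interior-speed clause.  One line: the NET core `integral_axisPressureDrop_le_of_lateral`
(`…HoopNetPressureDrop`, this seat: `axisLawCentre` + `sliceMassIdentity` + disc-mass FTC) fed with the LATERAL HOOP INEQUALITY
`HoopCore.lateralHoopInequality` (`…HoopLateral`, LEAD g15 t53-LEL).
WHAT THIS IS NOT: not NS, not E — an identity-plus-energy inequality for profile pairs; 19832 OPEN; NS regularity NOT proved.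
[nsreg-p2 g40 ROUND-50 §1; ns-idea-11 HOOP-NOTE §8]
-/

noncomputable section

open MeasureTheory Set Metric Real Function
open scoped InnerProductSpace RealInnerProductSpace Interval

set_option linter.dupNamespace false

namespace Summit.NavierStokesRegularity.NavierStokesRegularity.Theorems.PowerGaugeEulerLiouville.HoopCore

open Literature.Analysis Literature.Analysis.FluidPDE

/-- **THE NET AXIS PRESSURE-DROP LAW** (`NsregP2.R50.AxisPressureDropLaw γ`, text verbatim): for a `γ`-profile pair with ANY centre `c`,
`s₁ < s₂`, `T₀ > 0`, `2π∫_{s₁}^{s₂}(P(σe_z) − ⟨P⟩_θ(σ,T₀))dσ` is bounded by twice the tube's Dirichlet energy plus END-DISC terms only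
(`endFlux`, `discMass`, `endTermC`, `offsetTerm`). [nsreg-p2 g40 ROUND-50 §1; ns-idea-11 HOOP-NOTE §8] -/
theorem axisPressureDropLaw (γ : ℝ) :
    ∀ (c : EuclideanSpace ℝ (Fin 3)) (V : EuclideanSpace ℝ (Fin 3) → EuclideanSpace ℝ (Fin 3)) (P : EuclideanSpace ℝ (Fin 3) → ℝ),
      IsSelfSimilarEulerProfile γ c V P →
      ∀ (s₁ s₂ T₀ : ℝ), s₁ < s₂ → 0 < T₀ →
        2 * Real.pi * (∫ σ in s₁..s₂, (P (σ • eZ) - circleAvg P σ T₀))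
          ≤ 2 * (∫ y in solidCyl s₁ s₂ T₀, frobeniusNormSq (fderiv ℝ V y))
            + endFlux V s₁ T₀ + endFlux V s₂ T₀
            + 2 * Real.pi * γ * (discMass V s₁ T₀ - discMass V s₂ T₀)
            + 2 * Real.pi * (1 - 3 * γ) * (∫ t in (0 : ℝ)..T₀, (discMass V s₁ t - discMass V s₂ t) / t)
            + 2 * Real.pi * (endTermC γ c V T₀ s₂ - endTermC γ c V T₀ s₁)
            - 2 * Real.pi * (offsetTerm γ c V T₀ s₂ - offsetTerm γ c V T₀ s₁) := by
  intro c V P hprof s₁ s₂ T₀ hs hT₀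
  have hV1 : ContDiff ℝ 1 V := hprof.contDiff_velocity.of_le (by norm_num)
  exact integral_axisPressureDrop_le_of_lateral hprof hs hT₀ (lateralHoopInequality V s₁ s₂ T₀ hs hT₀ hV1 hprof.divFree)

end Summit.NavierStokesRegularity.NavierStokesRegularity.Theorems.PowerGaugeEulerLiouville.HoopCore

end
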